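import Literature.Probability.RandomPlanarGeometry.YangBaxterSAWLaw
import Mathlib.Combinatorics.SimpleGraph.Sum
import Mathlib.Combinatorics.SimpleGraph.Walk.Counting
import HarnessLib

/-!
# Port-gadget lattices over the square tiling; the compass lattice

Topic `Literature/Probability/RandomPlanarGeometry`; definition request `defn-portGadgetLattice`
(route `CriticalPhenomena/SAWScalingLimit/SAWCompassLattice`, idea card
`Summits/CriticalPhenomena/SAWScalingLimit/Ideas/compass-lattice-integrable-saw.md`).

The scaffold is Glazman–Manolescu's columnar rhombic tiling taken at all angles `θ = π/2`, i.e.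
the square tiling of the plane (A. Glazman, I. Manolescu, *Self-avoiding walk on `ℤ²` with
Yang–Baxter weights*, arXiv:1708.00395, §1 and Fig. 1; in the tree
`Literature.Probability.RandomPlanarGeometry.SAW.YangBaxter`: faces `Face = ℤ × ℤ`, mid-edges
`MidEdge`, the four sides `Side` of a face and `Face.side`, the plane embedding
`planeCorner`/`planeMidpoint`, the discretisation `meshFaces`). On it the route builds HONEST
self-avoiding walks by **port gadgets** (the route's own construction, see the idea card):

* a **port** (a vertex of degree `2`) sits on every edge of the tiling — we index it by the
  mid-edge itself, `Sum.inl e`;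
* a finite **gadget** graph `K` on a vertex type `W` is copied into every face `f`, its vertices
  being `Sum.inr (f, w)`; for each side `s` of the face a set `wired s ⊆ W` of gadget vertices
  ("terminals") is joined to the port on that side.

So the **port-gadget lattice** `PortGadget.lattice K` is the simple graph on
`MidEdge ⊕ Face × W` generated by `inl e ~ inr (f, w)` iff `w ∈ wired s` and `f.side s = e` for
some side `s`, and `inr (f, w) ~ inr (f, w')` iff `K.Adj w w'`; nothing else. A self-avoiding
path between two ports crosses every edge of the tiling at most once (ports have degree `2` when
each side has one terminal) and passes each face along vertex-disjoint internal routes; summing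
the internal routes turns edge fugacities into Glazman–Manolescu face weights
`(1, z² T_adj, z² T_opp, z⁴ D)` (the content of the route's item PortDictionary, not proved
here).

## Contents (namespace `Literature.Probability.RandomPlanarGeometry.SAW`)

* `PortGadget W` (a graph on `W` + the wiring `Side → Set W`), `PortGadget.ofTerminals`,
  `PortGadget.sum` (two gadgets in every face, on the same ports), `PortGadget.rel`,
  **`PortGadget.lattice`**; `PortGadget.fugacity y zp` (edge fugacities: `y` inside the gadget,
  `zp w` on the port edges at `w`), `PortGadget.walkWeight` (product of the fugacities of the
  darts of a walk), `PortGadget.embed pos` (ports at `planeMidpoint (π/2)`, i.e. the integer /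
  half-integer points, gadget vertex `w` of face `f` at `planeCorner (π/2) f + pos w`),
  `PortGadget.inFaces Δ` (vertices all of whose gadgets belong to faces of `Δ`),
  `PortGadget.pathMeasure` / `PortGadget.pathLaw` (the weighted counting measure on self-avoiding
  paths between two vertices staying in a vertex set, pushed to `CurveClass ℂ` by the rescaled
  polyline, and its normalisation).
* Generating functions of a finite weighted graph: `pathGF K y u v` (simple paths `u → v`) and
  `disjointPairGF K y u v u' v'` (vertex-disjoint pairs of simple paths), and for a gadget with
  terminals `term : Side → W` the terminal generating functions `terminalGF` (`T_{s,t}`),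
  `terminalPairGF` (`D_{s,t;s',t'}`).
* **The compass gadget** (`W = Fin 3 × Fin 4`; layer `0` = the terminals `Q_i`, layer `1` = the
  outer vertices `A_j`, layer `2` = the inner vertices `I_j`): `compassGadgetGraph` (outer
  8-cycle `Q_i ~ A_j` iff `j = i ∨ j + 1 = i`, spokes `A_j ~ I_j`, inner 4-cycle `I_j ~ I_{j+1}`),
  `compassTerm` (terminal `Q_i` on side `compassCyc i`, `compassCyc = ![W, N, E, S]`),
  `compassGadget`, the fugacities `compassGadgetFugacity α β s` (`α` outer cycle, `s` spokes,
  `β` inner cycle) and positions `compassPos` (`Q_i` at `centre + (3/8) dir i`, `A_j` at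
  `centre + (1/4)(dir j + dir (j+1))`, `I_j` at `centre + (1/8)(dir j + dir (j+1))`,
  `dir = ![-1, I, 1, -I]`). The route's items (PortDictionary, CompassSLE, SurfaceUniversality)
  spell the compass lattice out as an inline `let` chain; the definitions **`compassRel`,
  `compassLattice`, `compassFugacity`, `compassEmbedding`, `compassSupport`, `compassMeasure`,
  `compassLaw`** below copy that text verbatim, so that they are *definitionally* the route's
  objects (`compassLaw_eq_routeLet` is `rfl` on the whole chain), and `compassGadget_lattice`,
  `fugacity_compassGadgetFugacity`, `embed_compassPos` identify them with the generic
  construction.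
* The explicit polynomials `compassTadjPoly`, `compassToppPoly`, `compassDPoly` of item
  CompassRealisation (the claimed values of `T_adj`, `T_opp`, `D` for the compass gadget:
  `22` / `24` routes, `15` disjoint pairs; the identification is the route's computation and is
  NOT asserted here) and the terminal generating functions `compassTadj`, `compassTopp`,
  `compassD`, `compassDcross` they are claimed to equal.
* **The plus gadget** `plusGadget` (`W = Unit`: one centre vertex wired to the four ports; its
  port-to-port self-avoiding paths are the `ℤ²` walks on face centres with every edge split at its
  port, `walkWeight_plusFugacity : weight = p ^ length`), and **`compassPlusGadget`**, the union
  `Γ⁺ = compass ∪ plus` on the same ports with its five fugacity classes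
  `compassPlusFugacity α β s z p`.

Geometry at `θ = π/2` (faces are unit squares, gadget vertices lie inside their face), local
finiteness, the degree of ports and the dihedral symmetry are in `PortGadgetLatticeGeometry.lean`.

## Design choices

* The wiring is a SET of terminals per side (not an injection `Side ↪ W`) so that the plus gadget
  (one vertex wired to all four sides) and unions of gadgets (`PortGadget.sum`: a port is then
  wired to one terminal of each gadget of each adjacent face) are instances of one construction.
* Fugacities are plain functions `V → V → ℝ` evaluated on darts (values off the edge set are
  irrelevant), as in the route's text; weights of walks are real products, measures are clamped
  to `ℝ≥0∞` by `ENNReal.ofReal` as in `YangBaxterSAWLaw.lean`.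
* Searches: `lean search 'portGadget|compassLattice|Gadget'` — no port-gadget / decorated-lattice
  SAW construction in Mathlib or the tree (`Literature.Probability.Percolation.Gadget`,
  `…MacroRenormalization.GadgetSystem` are unrelated percolation objects;
  `Literature.Probability.RandomPlanarGeometry.SAW.Zd.walkWeight` is the Domb–Joyce weight).
-/

noncomputable section

open MeasureTheory Literature.Probability.LatticeModels
open scoped ENNReal

namespace Literature.Probability.RandomPlanarGeometry.SAW

open YangBaxter
open Complex (I)

/-! ### Port gadgets and the port-gadget lattice -/

/-- A **port gadget**: a (finite) simple graph `graph` on the vertex type `W`, to be copied into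
every face of the square tiling, together with, for each side `s` of the face, the set
`wired s` of its vertices joined by an edge to the port sitting on that side.
[cite: GlazmanManolescu2019, §1 and Fig. 1 (the tiling); the gadget construction is the route's (idea card compass-lattice-integrable-saw)] -/
structure PortGadget (W : Type*) where
  /-- the gadget graph, one copy per face -/
  graph : SimpleGraph W
  /-- the gadget vertices wired to the port on side `s` of the face -/
  wired : Side → Set W

/-- The constant angle sequence `Θ ≡ π/2`: Glazman–Manolescu's tiling by squares.
[cite: GlazmanManolescu2019, §1] -/
abbrev rightAngles : ℤ → ℝ := fun _ => Real.pi / 2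

namespace PortGadget

variable {W W₁ W₂ : Type*}

/-- The gadget with exactly one terminal `term s` on each side. [folklore] -/
def ofTerminals (K : SimpleGraph W) (term : Side → W) : PortGadget W where
  graph := K
  wired s := {term s}

/-- Two gadgets in every face, on the same ports (the union lattice `Γ⁺ = compass ∪ plus` of the
route is `compassGadget.sum plusGadget`). [folklore] -/
protected def sum (K₁ : PortGadget W₁) (K₂ : PortGadget W₂) : PortGadget (W₁ ⊕ W₂) where
  graph := K₁.graph ⊕g K₂.graph
  wired s := Sum.inl '' K₁.wired s ∪ Sum.inr '' K₂.wired s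

/-- The generating relation of the port-gadget lattice: port `e` — gadget vertex `(f, w)` when `w`
is wired to a side `s` of `f` lying on `e`; `(f, w)` — `(f, w')` when `w ~ w'` in the gadget.
[folklore] -/
def rel (K : PortGadget W) : MidEdge ⊕ Face × W → MidEdge ⊕ Face × W → Prop
  | .inl e, .inr (f, w) => ∃ s, w ∈ K.wired s ∧ f.side s = e
  | .inr (f, w), .inr (f', w') => f = f' ∧ K.graph.Adj w w'
  | _, _ => False

/-- **The port-gadget lattice** of the gadget `K` over the square tiling: the simple graph on
`MidEdge ⊕ Face × W` (ports ⊔ one copy of `W` per face) generated by `K.rel`.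
[cite: GlazmanManolescu2019, §1 and Fig. 1 (the tiling); the gadget construction is the route's (idea card compass-lattice-integrable-saw)] -/
def lattice (K : PortGadget W) : SimpleGraph (MidEdge ⊕ Face × W) :=
  SimpleGraph.fromRel K.rel

/-- Two ports are never adjacent. [folklore] -/
@[simp] theorem lattice_adj_inl_inl (K : PortGadget W) (e e' : MidEdge) :
    ¬K.lattice.Adj (.inl e) (.inl e') := by
  simp [lattice, SimpleGraph.fromRel_adj, rel]

/-- Port — gadget vertex adjacency. [folklore] -/
@[simp] theorem lattice_adj_inl_inr (K : PortGadget W) (e : MidEdge) (f : Face) (w : W) :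
    K.lattice.Adj (.inl e) (.inr (f, w)) ↔ ∃ s, w ∈ K.wired s ∧ f.side s = e := by
  simp [lattice, SimpleGraph.fromRel_adj, rel]

/-- Gadget vertex — port adjacency. [folklore] -/
@[simp] theorem lattice_adj_inr_inl (K : PortGadget W) (e : MidEdge) (f : Face) (w : W) :
    K.lattice.Adj (.inr (f, w)) (.inl e) ↔ ∃ s, w ∈ K.wired s ∧ f.side s = e := by
  rw [SimpleGraph.adj_comm, lattice_adj_inl_inr]

/-- Gadget vertex — gadget vertex adjacency: same face, adjacent in the gadget. [folklore] -/
@[simp] theorem lattice_adj_inr_inr (K : PortGadget W) (f f' : Face) (w w' : W) :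
    K.lattice.Adj (.inr (f, w)) (.inr (f', w')) ↔ f = f' ∧ K.graph.Adj w w' := by
  simp only [lattice, SimpleGraph.fromRel_adj, rel, ne_eq, Sum.inr.injEq, Prod.mk.injEq]
  constructor
  · rintro ⟨-, ⟨rfl, h⟩ | ⟨rfl, h⟩⟩
    exacts [⟨rfl, h⟩, ⟨rfl, h.symm⟩]
  · rintro ⟨rfl, h⟩
    exact ⟨fun hw => h.ne hw.2, Or.inl ⟨rfl, h⟩⟩

/-! ### Fugacities, weights, embedding, support -/

/-- Edge fugacities of a port-gadget lattice: `zp w` on the port edges at the gadget vertex `w`,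
`y w w'` on the gadget edges (values on non-adjacent pairs are irrelevant). [folklore] -/
def fugacity (y : W → W → ℝ) (zp : W → ℝ) : MidEdge ⊕ Face × W → MidEdge ⊕ Face × W → ℝ
  | .inl _, .inr (_, w) => zp w
  | .inr (_, w), .inl _ => zp w
  | .inr (_, w), .inr (_, w') => y w w'
  | _, _ => 0

/-- The weight of a walk for edge fugacities `y`: the product of `y` over its darts (for a
self-avoiding walk, the product of the fugacities of its edges). [folklore] -/
def walkWeight {V R : Type*} [Mul R] [One R] {G : SimpleGraph V} (y : V → V → R) {u v : V}
    (p : G.Walk u v) : R :=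
  (p.darts.map fun d => y d.fst d.snd).prod

/-- The trivial walk has weight `1`. [folklore] -/
@[simp] theorem walkWeight_nil {V R : Type*} [Mul R] [One R] {G : SimpleGraph V} (y : V → V → R)
    (u : V) : walkWeight y (SimpleGraph.Walk.nil : G.Walk u u) = 1 := rfl

/-- Prepending an edge multiplies the weight by its fugacity. [folklore] -/
@[simp] theorem walkWeight_cons {V R : Type*} [Mul R] [One R] {G : SimpleGraph V} (y : V → V → R)
    {u v w : V} (h : G.Adj u v) (p : G.Walk v w) :
    walkWeight y (SimpleGraph.Walk.cons h p) = y u v * walkWeight y p := rfl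

/-- The straight-line drawing of a port-gadget lattice: the port on `e` at the midpoint
`planeMidpoint (π/2) e` of its edge (an integer or half-integer point), the gadget vertex `w` of
the face `f` at `planeCorner (π/2) f + pos w` (inside the unit square of `f` when
`pos w ∈ (0,1) × (0,1)`). [folklore] -/
def embed (pos : W → ℂ) : MidEdge ⊕ Face × W → ℂ
  | .inl e => planeMidpoint rightAngles e
  | .inr (f, w) => planeCorner rightAngles f + pos w

/-- The vertices all of whose gadget copies belong to faces of `Δ` (every port qualifies): walks
"using only gadgets of faces in `Δ`" are the walks supported in this set. [folklore] -/
def inFaces (Δ : Set Face) : Set (MidEdge ⊕ Face × W) :=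
  {v | ∀ f q, v = Sum.inr (f, q) → f ∈ Δ}

/-- Every port lies in `inFaces Δ`. [folklore] -/
@[simp] theorem inl_mem_inFaces (Δ : Set Face) (e : MidEdge) :
    (Sum.inl e : MidEdge ⊕ Face × W) ∈ inFaces Δ := fun _ _ h => by cases h

/-- A gadget vertex lies in `inFaces Δ` iff its face is in `Δ`. [folklore] -/
@[simp] theorem inr_mem_inFaces (Δ : Set Face) (f : Face) (w : W) :
    (Sum.inr (f, w) : MidEdge ⊕ Face × W) ∈ inFaces Δ ↔ f ∈ Δ :=
  ⟨fun h => h f w rfl, fun h f' q hq => by cases hq; exact h⟩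

/-- `inFaces` is monotone. [folklore] -/
theorem inFaces_mono {Δ Δ' : Set Face} (h : Δ ⊆ Δ') : (inFaces Δ : Set (MidEdge ⊕ Face × W)) ⊆ inFaces Δ' :=
  fun _ hv f q hq => h (hv f q hq)

/-- **The weighted counting measure of self-avoiding paths**, pushed to curves: for a graph `G` on
`V` with fugacities `y`, drawing `emb` and mesh `δ`, the path `p : u → v` all of whose vertices lie
in `S` gets mass `walkWeight y p` (clamped to `ℝ≥0∞`) at the curve class of the rescaled polyline
`δ · emb` through its vertices. [folklore] -/
def pathMeasure {V : Type*} (G : SimpleGraph V) (y : V → V → ℝ) (emb : V → ℂ) (S : Set V) (δ : ℝ)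
    (u v : V) : Measure (CurveClass ℂ) :=
  Measure.sum (fun p : {p : G.Walk u v // p.IsPath ∧ ∀ v ∈ p.support, v ∈ S} =>
    ENNReal.ofReal (walkWeight y p.1) • Measure.dirac (CurveClass.mk ⟨p.1.toCurve fun v => (δ : ℂ) * emb v⟩))

/-- **The law of the weighted self-avoiding path** from `u` to `v` through `S`, as a measure on
`CurveClass ℂ`: the normalisation of `pathMeasure` (junk value `0` if the total mass is `0` or
`∞`). [folklore] -/
def pathLaw {V : Type*} (G : SimpleGraph V) (y : V → V → ℝ) (emb : V → ℂ) (S : Set V) (δ : ℝ)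
    (u v : V) : Measure (CurveClass ℂ) :=
  (pathMeasure G y emb S δ u v Set.univ)⁻¹ • pathMeasure G y emb S δ u v

end PortGadget

/-! ### Generating functions of simple paths in a finite weighted graph -/

section GeneratingFunctions

variable {W : Type*} (K : SimpleGraph W) [Fintype W] [DecidableEq W] [DecidableRel K.Adj]
variable {R : Type*} [CommSemiring R]

/-- `Σ_{p : u → v simple} ∏_{edges of p} y`: the generating function of the simple paths of `K`
from `u` to `v` with edge fugacities `y`. [folklore] -/
def pathGF (y : W → W → R) (u v : W) : R :=
  ∑ p : K.Path u v, PortGadget.walkWeight y p.1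

open Classical in
/-- The generating function of the ordered pairs (simple path `u → v`, simple path `u' → v'`)
that are vertex-disjoint. [folklore] -/
def disjointPairGF (y : W → W → R) (u v u' v' : W) : R :=
  ∑ p : K.Path u v, ∑ q : K.Path u' v',
    if p.1.support.Disjoint q.1.support then PortGadget.walkWeight y p.1 * PortGadget.walkWeight y q.1
    else 0

/-- **`T_{s,t}`**: the generating function of the internal routes of a gadget between its terminals
on the sides `s` and `t` (simple paths of the gadget graph; routes through the other terminals
are included). A face passed once, from the port on side `s` to the port on side `t`, has total
weight `z² T_{s,t}` when the port edges have fugacity `z`.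
[cite: GlazmanManolescu2019, Fig. 1 (the passage types); the dictionary is the route's (idea card compass-lattice-integrable-saw)] -/
def terminalGF (term : Side → W) (y : W → W → R) (s t : Side) : R :=
  pathGF K y (term s) (term t)

/-- **`D_{s,t;s',t'}`**: the generating function of the vertex-disjoint pairs (route `s → t`,
route `s' → t'`) of a gadget — a face passed twice has total weight `z⁴ D`.
[cite: GlazmanManolescu2019, Fig. 1 (the passage types); the dictionary is the route's (idea card compass-lattice-integrable-saw)] -/
def terminalPairGF (term : Side → W) (y : W → W → R) (s t s' t' : Side) : R :=
  disjointPairGF K y (term s) (term t) (term s') (term t')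

end GeneratingFunctions

/-! ### The compass gadget -/

/-- The cyclic order of the sides used to index the compass terminals: `Q₀, Q₁, Q₂, Q₃` sit on the
sides `W, N, E, S`. [folklore] -/
def compassCyc : Fin 4 → Side := ![Side.W, Side.N, Side.E, Side.S]

/-- The terminal of the compass gadget on each side (the inverse of `compassCyc`):
`Q₀ = (0,0)` on `W`, `Q₁` on `N`, `Q₂` on `E`, `Q₃` on `S`. [folklore] -/
def compassTerm : Side → Fin 3 × Fin 4
  | .W => (0, 0)
  | .N => (0, 1)
  | .E => (0, 2)
  | .S => (0, 3)

/-- `Q₀` sits on the West side. [folklore] -/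
@[simp] theorem compassCyc_zero : compassCyc 0 = .W := rfl

/-- `Q₁` sits on the North side. [folklore] -/
@[simp] theorem compassCyc_one : compassCyc 1 = .N := rfl

/-- `Q₂` sits on the East side. [folklore] -/
@[simp] theorem compassCyc_two : compassCyc 2 = .E := rfl

/-- `Q₃` sits on the South side. [folklore] -/
@[simp] theorem compassCyc_three : compassCyc 3 = .S := rfl

/-- `compassTerm` inverts `compassCyc`. [folklore] -/
@[simp] theorem compassTerm_compassCyc (i : Fin 4) : compassTerm (compassCyc i) = (0, i) := by
  fin_cases i <;> rfl

/-- `compassCyc` inverts `compassTerm`. [folklore] -/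
@[simp] theorem compassCyc_compassTerm_snd (s : Side) : compassCyc (compassTerm s).2 = s := by
  cases s <;> rfl

/-- Terminals are on layer `0`. [folklore] -/
@[simp] theorem compassTerm_fst (s : Side) : (compassTerm s).1 = 0 := by
  cases s <;> rfl

/-- `compassTerm` is injective (four distinct terminals). [folklore] -/
theorem compassTerm_injective : Function.Injective compassTerm := by
  intro s t h
  have := congrArg (fun q => compassCyc q.2) h
  simpa using this

/-- **The compass gadget graph** on `Fin 3 × Fin 4` (layer, index): the outer 8-cycle
`Q_i ~ A_j` iff `j = i ∨ j + 1 = i` (`Q_i = (0, i)`, `A_j = (1, j)`), the spokes `A_j ~ I_j`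
(`I_j = (2, j)`) and the inner 4-cycle `I_j ~ I_{j+1}`.
[cite: GlazmanManolescu2019, §1 (the scaffold); the gadget is the route's (idea card compass-lattice-integrable-saw)] -/
def compassGadgetGraph : SimpleGraph (Fin 3 × Fin 4) :=
  SimpleGraph.fromRel fun q q' =>
    (q.1 = 0 ∧ q'.1 = 1 ∧ (q'.2 = q.2 ∨ q'.2 + 1 = q.2)) ∨ (q.1 = 1 ∧ q'.1 = 2 ∧ q'.2 = q.2) ∨
      (q.1 = 2 ∧ q'.1 = 2 ∧ q'.2 = q.2 + 1)

/-- Adjacency in the compass gadget is decidable (for enumerations). [folklore] -/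
instance : DecidableRel compassGadgetGraph.Adj := fun q q' =>
  inferInstanceAs (Decidable (q ≠ q' ∧ _))

/-- **The compass gadget**: `compassGadgetGraph` with terminal `Q_i` wired to the side
`compassCyc i`. [cite: GlazmanManolescu2019, §1 (the scaffold); the gadget is the route's (idea card compass-lattice-integrable-saw)] -/
def compassGadget : PortGadget (Fin 3 × Fin 4) :=
  PortGadget.ofTerminals compassGadgetGraph compassTerm

/-- The compass gadget fugacities: `α` on the outer 8-cycle (edges at a terminal), `s` on the
spokes (the other edges at an `A_j`), `β` on the inner 4-cycle. [folklore] -/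
def compassGadgetFugacity (α β s : ℝ) : Fin 3 × Fin 4 → Fin 3 × Fin 4 → ℝ := fun q q' =>
  if q.1 = 0 ∨ q'.1 = 0 then α else if q.1 = 1 ∨ q'.1 = 1 then s else β

/-- The four compass directions `W, N, E, S ↦ -1, i, 1, -i` (indexed like `compassCyc`).
[folklore] -/
def compassDir : Fin 4 → ℂ := ![-1, Complex.I, 1, -Complex.I]

/-- Positions of the compass vertices inside the unit square of a face, relative to its
lower-left corner: `Q_i` at `centre + (3/8) dir i`, `A_j` at `centre + (1/4)(dir j + dir (j+1))`,
`I_j` at `centre + (1/8)(dir j + dir (j+1))`, `centre = (1 + i)/2`. [folklore] -/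
def compassPos : Fin 3 × Fin 4 → ℂ := fun q =>
  (1 + Complex.I) / 2 +
    (if q.1 = 0 then (3 / 8 : ℂ) * compassDir q.2
      else (if q.1 = 1 then (1 / 4 : ℂ) else (1 / 8 : ℂ)) * (compassDir q.2 + compassDir (q.2 + 1)))

/-! ### The compass lattice, verbatim as in the route's items -/

/-- The generating relation of the compass lattice, VERBATIM the `R` of the route's items (with
`cyc = ![W, N, E, S]` inlined): port `e` — terminal `(f, (0, i))` iff `f.side (cyc i) = e`;
`(f, (0, i))` — `(f, (1, j))` iff `j = i ∨ j + 1 = i`; `(f, (1, j))` — `(f, (2, j))`;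
`(f, (2, j))` — `(f, (2, j + 1))`. [folklore] -/
def compassRel : (MidEdge ⊕ Face × Fin 3 × Fin 4) → (MidEdge ⊕ Face × Fin 3 × Fin 4) → Prop :=
  fun x x' => (match x, x' with
    | Sum.inl e, Sum.inr (f, (l, i)) => l = 0 ∧ f.side (![Side.W, Side.N, Side.E, Side.S] i) = e
    | Sum.inr (f, (l, i)), Sum.inr (f', (l', i')) => f = f' ∧ ((l = 0 ∧ l' = 1 ∧ (i' = i ∨ i' + 1 = i)) ∨
        (l = 1 ∧ l' = 2 ∧ i' = i) ∨ (l = 2 ∧ l' = 2 ∧ i' = i + 1))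
    | _, _ => False)

/-- **The compass lattice `Γ*`** (as a graph; the fugacities are `compassFugacity`): the
port-gadget lattice of the compass gadget, VERBATIM the `G := SimpleGraph.fromRel R` of the
route's items; equal to `compassGadget.lattice` (`compassGadget_lattice`).
[cite: GlazmanManolescu2019, §1 (the scaffold); the gadget is the route's (idea card compass-lattice-integrable-saw)] -/
def compassLattice : SimpleGraph (MidEdge ⊕ Face × Fin 3 × Fin 4) :=
  SimpleGraph.fromRel compassRel

/-- The compass edge fugacities, VERBATIM the `y` of the route's items: `z` on port–terminal
edges, `α` at layer `0`, `s` at layer `1`, `β` otherwise. [folklore] -/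
def compassFugacity (α β s z : ℝ) :
    (MidEdge ⊕ Face × Fin 3 × Fin 4) → (MidEdge ⊕ Face × Fin 3 × Fin 4) → ℝ :=
  fun x x' => (match x, x' with
    | Sum.inl _, Sum.inr _ => z
    | Sum.inr _, Sum.inl _ => z
    | Sum.inr (_, (l, _)), Sum.inr (_, (l', _)) => if l = 0 ∨ l' = 0 then α else if l = 1 ∨ l' = 1 then s else β
    | _, _ => 0)

/-- The straight-line drawing of the compass lattice, VERBATIM the `emb` of the route's items.
[folklore] -/
def compassEmbedding : (MidEdge ⊕ Face × Fin 3 × Fin 4) → ℂ :=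
  fun x => (match x with
    | Sum.inl e => planeMidpoint (fun (_ : ℤ) => Real.pi / 2) e
    | Sum.inr (f, (l, i)) => planeCorner (fun (_ : ℤ) => Real.pi / 2) f + (1 + Complex.I) / 2 +
        (if l = 0 then (3 / 8 : ℂ) * compassDir i
          else (if l = 1 then (1 / 4 : ℂ) else (1 / 8 : ℂ)) * (compassDir i + compassDir (i + 1))))

/-- The vertices usable in the discrete domain `Ω_δ`: gadgets of faces of
`meshFaces (π/2) Ω δ` only, VERBATIM the `S` of the route's items (`= inFaces (meshFaces …)`,
`compassSupport_eq_inFaces`). [folklore] -/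
def compassSupport (Ω : Set ℂ) (δ : ℝ) : Set (MidEdge ⊕ Face × Fin 3 × Fin 4) :=
  {v | ∀ f q, v = Sum.inr (f, q) → f ∈ meshFaces (fun (_ : ℤ) => Real.pi / 2) Ω δ}

/-- **The compass SAW measure** of `Ω_δ` from port `a` to port `b` at fugacities `(α, β, s, z)`,
pushed to `CurveClass ℂ`, VERBATIM the `μ` of the route's items. [folklore] -/
def compassMeasure (α β s z : ℝ) (Ω : Set ℂ) (δ : ℝ) (a b : MidEdge) : Measure (CurveClass ℂ) :=
  PortGadget.pathMeasure compassLattice (compassFugacity α β s z) compassEmbedding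
    (compassSupport Ω δ) δ (Sum.inl a) (Sum.inl b)

/-- **The compass chordal law** of `Ω_δ` from port `a` to port `b`, VERBATIM the `law` of the
route's items CompassSLE / SurfaceUniversality. [folklore] -/
def compassLaw (α β s z : ℝ) (Ω : Set ℂ) (δ : ℝ) (a b : MidEdge) : Measure (CurveClass ℂ) :=
  PortGadget.pathLaw compassLattice (compassFugacity α β s z) compassEmbedding
    (compassSupport Ω δ) δ (Sum.inl a) (Sum.inl b)

/-- **Bridge to the route's text.** The whole inline `let` chain of the items of route
`SAWCompassLattice` (as rendered in its thesis), ending in `law`, is definitionally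
`compassLaw α β s z`. [folklore] -/
theorem compassLaw_eq_routeLet (α β s z : ℝ) :
    (let cyc : Fin 4 → Side := ![Side.W, Side.N, Side.E, Side.S]
    let R : (MidEdge ⊕ Face × Fin 3 × Fin 4) → (MidEdge ⊕ Face × Fin 3 × Fin 4) → Prop :=
      fun x x' => (match x, x' with
        | Sum.inl e, Sum.inr (f, (l, i)) => l = 0 ∧ f.side (cyc i) = e
        | Sum.inr (f, (l, i)), Sum.inr (f', (l', i')) => f = f' ∧ ((l = 0 ∧ l' = 1 ∧ (i' = i ∨ i' + 1 = i)) ∨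
            (l = 1 ∧ l' = 2 ∧ i' = i) ∨ (l = 2 ∧ l' = 2 ∧ i' = i + 1))
        | _, _ => False)
    let G : SimpleGraph (MidEdge ⊕ Face × Fin 3 × Fin 4) := SimpleGraph.fromRel R
    let y : (MidEdge ⊕ Face × Fin 3 × Fin 4) → (MidEdge ⊕ Face × Fin 3 × Fin 4) → ℝ :=
      fun x x' => (match x, x' with
        | Sum.inl _, Sum.inr _ => z
        | Sum.inr _, Sum.inl _ => z
        | Sum.inr (_, (l, _)), Sum.inr (_, (l', _)) => if l = 0 ∨ l' = 0 then α else if l = 1 ∨ l' = 1 then s else β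
        | _, _ => 0)
    let wt : ∀ {u v : (MidEdge ⊕ Face × Fin 3 × Fin 4)}, G.Walk u v → ℝ :=
      fun p => (p.darts.map fun d => y d.fst d.snd).prod
    let dir : Fin 4 → ℂ := ![-1, Complex.I, 1, -Complex.I]
    let emb : (MidEdge ⊕ Face × Fin 3 × Fin 4) → ℂ := fun x => (match x with
      | Sum.inl e => planeMidpoint (fun (_ : ℤ) => Real.pi / 2) e
      | Sum.inr (f, (l, i)) => planeCorner (fun (_ : ℤ) => Real.pi / 2) f + (1 + Complex.I) / 2 +
          (if l = 0 then (3 / 8 : ℂ) * dir i else (if l = 1 then (1 / 4 : ℂ) else (1 / 8 : ℂ)) * (dir i + dir (i + 1))))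
    let S : Set ℂ → ℝ → Set (MidEdge ⊕ Face × Fin 3 × Fin 4) := fun Ω δ =>
      {v | ∀ f q, v = Sum.inr (f, q) → f ∈ meshFaces (fun (_ : ℤ) => Real.pi / 2) Ω δ}
    let μ : Set ℂ → ℝ → MidEdge → MidEdge → Measure (CurveClass ℂ) := fun Ω δ a b =>
      Measure.sum (fun p : {p : G.Walk (Sum.inl a) (Sum.inl b) // p.IsPath ∧ ∀ v ∈ p.support, v ∈ S Ω δ} =>
        ENNReal.ofReal (wt p.1) • Measure.dirac (CurveClass.mk ⟨p.1.toCurve fun v => (δ : ℂ) * emb v⟩))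
    let law : Set ℂ → ℝ → MidEdge → MidEdge → Measure (CurveClass ℂ) := fun Ω δ a b =>
      (μ Ω δ a b Set.univ)⁻¹ • μ Ω δ a b
    law) = compassLaw α β s z := rfl

/-- The route's inline graph `G` is `compassLattice` (definitionally). [folklore] -/
theorem compassLattice_eq_routeLet :
    (let cyc : Fin 4 → Side := ![Side.W, Side.N, Side.E, Side.S]
    let R : (MidEdge ⊕ Face × Fin 3 × Fin 4) → (MidEdge ⊕ Face × Fin 3 × Fin 4) → Prop :=
      fun x x' => (match x, x' with
        | Sum.inl e, Sum.inr (f, (l, i)) => l = 0 ∧ f.side (cyc i) = e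
        | Sum.inr (f, (l, i)), Sum.inr (f', (l', i')) => f = f' ∧ ((l = 0 ∧ l' = 1 ∧ (i' = i ∨ i' + 1 = i)) ∨
            (l = 1 ∧ l' = 2 ∧ i' = i) ∨ (l = 2 ∧ l' = 2 ∧ i' = i + 1))
        | _, _ => False)
    SimpleGraph.fromRel R) = compassLattice := rfl


/-! ### The compass lattice is the port-gadget lattice of the compass gadget -/

/-- Adjacency in the compass gadget graph, unfolded. [folklore] -/
theorem compassGadgetGraph_adj (q q' : Fin 3 × Fin 4) :
    compassGadgetGraph.Adj q q' ↔ q ≠ q' ∧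
      (((q.1 = 0 ∧ q'.1 = 1 ∧ (q'.2 = q.2 ∨ q'.2 + 1 = q.2)) ∨ (q.1 = 1 ∧ q'.1 = 2 ∧ q'.2 = q.2) ∨
          (q.1 = 2 ∧ q'.1 = 2 ∧ q'.2 = q.2 + 1)) ∨
        ((q'.1 = 0 ∧ q.1 = 1 ∧ (q.2 = q'.2 ∨ q.2 + 1 = q'.2)) ∨ (q'.1 = 1 ∧ q.1 = 2 ∧ q.2 = q'.2) ∨
          (q'.1 = 2 ∧ q.1 = 2 ∧ q.2 = q'.2 + 1))) := by
  simp [compassGadgetGraph, SimpleGraph.fromRel_adj]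

/-- `compassRel` between a port and a gadget vertex, unfolded. [folklore] -/
@[simp] theorem compassRel_inl_inr (e : MidEdge) (f : Face) (l : Fin 3) (i : Fin 4) :
    compassRel (.inl e) (.inr (f, (l, i))) ↔ l = 0 ∧ f.side (compassCyc i) = e := Iff.rfl

/-- `compassRel` between two gadget vertices, unfolded. [folklore] -/
@[simp] theorem compassRel_inr_inr (f f' : Face) (l l' : Fin 3) (i i' : Fin 4) :
    compassRel (.inr (f, (l, i))) (.inr (f', (l', i'))) ↔ f = f' ∧
      ((l = 0 ∧ l' = 1 ∧ (i' = i ∨ i' + 1 = i)) ∨ (l = 1 ∧ l' = 2 ∧ i' = i) ∨ (l = 2 ∧ l' = 2 ∧ i' = i + 1)) :=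
  Iff.rfl

/-- `compassRel` never relates a gadget vertex to a port (in this order). [folklore] -/
@[simp] theorem compassRel_inr_inl (e : MidEdge) (f : Face) (q : Fin 3 × Fin 4) :
    ¬compassRel (.inr (f, q)) (.inl e) := fun h => h

/-- `compassRel` never relates two ports. [folklore] -/
@[simp] theorem compassRel_inl_inl (e e' : MidEdge) : ¬compassRel (.inl e) (.inl e') := fun h => h

/-- `compassRel` is decidable. [folklore] -/
instance : DecidableRel compassRel := fun x x' => by
  rcases x with e | ⟨f, l, i⟩ <;> rcases x' with e' | ⟨f', l', i'⟩
  · exact inferInstanceAs (Decidable False)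
  · exact inferInstanceAs (Decidable (l' = 0 ∧ _))
  · exact inferInstanceAs (Decidable False)
  · exact inferInstanceAs (Decidable (f = f' ∧ _))

/-- Adjacency in the compass lattice is decidable. [folklore] -/
instance : DecidableRel compassLattice.Adj := fun x x' =>
  inferInstanceAs (Decidable (x ≠ x' ∧ _))

/-- Two ports are never adjacent in the compass lattice. [folklore] -/
@[simp] theorem compassLattice_adj_inl_inl (e e' : MidEdge) : ¬compassLattice.Adj (.inl e) (.inl e') := by
  simp [compassLattice, SimpleGraph.fromRel_adj]

/-- Port — compass vertex adjacency: the terminal `Q_i` of a face `f` with `f.side (cyc i) = e`.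
[folklore] -/
@[simp] theorem compassLattice_adj_inl_inr (e : MidEdge) (f : Face) (l : Fin 3) (i : Fin 4) :
    compassLattice.Adj (.inl e) (.inr (f, (l, i))) ↔ l = 0 ∧ f.side (compassCyc i) = e := by
  simp [compassLattice, SimpleGraph.fromRel_adj]

/-- Compass vertex — port adjacency. [folklore] -/
@[simp] theorem compassLattice_adj_inr_inl (e : MidEdge) (f : Face) (l : Fin 3) (i : Fin 4) :
    compassLattice.Adj (.inr (f, (l, i))) (.inl e) ↔ l = 0 ∧ f.side (compassCyc i) = e := by
  rw [SimpleGraph.adj_comm, compassLattice_adj_inl_inr]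

/-- Compass vertex — compass vertex adjacency: same face, adjacent in the compass gadget.
[folklore] -/
@[simp] theorem compassLattice_adj_inr_inr (f f' : Face) (q q' : Fin 3 × Fin 4) :
    compassLattice.Adj (.inr (f, q)) (.inr (f', q')) ↔ f = f' ∧ compassGadgetGraph.Adj q q' := by
  obtain ⟨l, i⟩ := q
  obtain ⟨l', i'⟩ := q'
  simp only [compassLattice, SimpleGraph.fromRel_adj, ne_eq, Sum.inr.injEq, Prod.mk.injEq,
    compassRel_inr_inr, compassGadgetGraph_adj]
  constructor
  · rintro ⟨hne, ⟨rfl, h⟩ | ⟨rfl, h⟩⟩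
    · exact ⟨rfl, fun h' => hne ⟨rfl, h'⟩, Or.inl h⟩
    · exact ⟨rfl, fun h' => hne ⟨rfl, h'⟩, Or.inr h⟩
  · rintro ⟨rfl, hne, h | h⟩
    · exact ⟨fun h' => hne h'.2, Or.inl ⟨rfl, h⟩⟩
    · exact ⟨fun h' => hne h'.2, Or.inr ⟨rfl, h⟩⟩

/-- **The compass lattice is the port-gadget lattice of the compass gadget.** [folklore] -/
theorem compassGadget_lattice : compassGadget.lattice = compassLattice := by
  ext x x'
  rcases x with e | ⟨f, l, i⟩ <;> rcases x' with e' | ⟨f', l', i'⟩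
  · simp
  · simp only [PortGadget.lattice_adj_inl_inr, compassLattice_adj_inl_inr, compassGadget,
      PortGadget.ofTerminals, Set.mem_singleton_iff]
    constructor
    · rintro ⟨s, hs, rfl⟩
      have h1 := congrArg Prod.fst hs
      have h2 := congrArg (fun q => compassCyc q.2) hs
      simp only [compassTerm_fst, compassCyc_compassTerm_snd] at h1 h2
      exact ⟨h1, by rw [h2]⟩
    · rintro ⟨rfl, rfl⟩
      exact ⟨compassCyc i', by simp, rfl⟩
  · simp only [PortGadget.lattice_adj_inr_inl, compassLattice_adj_inr_inl, compassGadget,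
      PortGadget.ofTerminals, Set.mem_singleton_iff]
    constructor
    · rintro ⟨s, hs, rfl⟩
      have h1 := congrArg Prod.fst hs
      have h2 := congrArg (fun q => compassCyc q.2) hs
      simp only [compassTerm_fst, compassCyc_compassTerm_snd] at h1 h2
      exact ⟨h1, by rw [h2]⟩
    · rintro ⟨rfl, rfl⟩
      exact ⟨compassCyc i, by simp, rfl⟩
  · simp [compassGadget, PortGadget.ofTerminals]

/-- The compass fugacities are the generic port-gadget fugacities of `compassGadgetFugacity` with
port fugacity `z`. [folklore] -/
theorem fugacity_compassGadgetFugacity (α β s z : ℝ) :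
    PortGadget.fugacity (compassGadgetFugacity α β s) (fun _ => z) = compassFugacity α β s z := by
  funext x x'
  rcases x with e | ⟨f, l, i⟩ <;> rcases x' with e' | ⟨f', l', i'⟩ <;> rfl

/-- The compass drawing is the generic port-gadget drawing with positions `compassPos`.
[folklore] -/
theorem embed_compassPos : PortGadget.embed compassPos = compassEmbedding := by
  funext x
  rcases x with e | ⟨f, l, i⟩
  · rfl
  · simp only [PortGadget.embed, compassPos, compassEmbedding, add_assoc]

/-- The compass support set is `inFaces` of the discretised domain. [folklore] -/
theorem compassSupport_eq_inFaces (Ω : Set ℂ) (δ : ℝ) :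
    compassSupport Ω δ = PortGadget.inFaces (meshFaces rightAngles Ω δ) := rfl

/-- `compassMeasure` is the generic path measure of the compass data. [folklore] -/
theorem compassMeasure_eq (α β s z : ℝ) (Ω : Set ℂ) (δ : ℝ) (a b : MidEdge) :
    compassMeasure α β s z Ω δ a b =
      PortGadget.pathMeasure compassGadget.lattice (PortGadget.fugacity (compassGadgetFugacity α β s) fun _ => z)
        (PortGadget.embed compassPos) (PortGadget.inFaces (meshFaces rightAngles Ω δ)) δ (.inl a) (.inl b) := by
  rw [compassGadget_lattice, fugacity_compassGadgetFugacity, embed_compassPos]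
  rfl

/-! ### Terminal generating functions of the compass gadget; the CompassRealisation polynomials -/

section CompassPolynomials

variable {R : Type*} [CommSemiring R]

/-- The compass gadget fugacities with values in any commutative semiring (for symbolic
computation): `α` at layer `0`, `s` at layer `1`, `β` otherwise. [folklore] -/
def compassGadgetFugacity' (α β s : R) : Fin 3 × Fin 4 → Fin 3 × Fin 4 → R := fun q q' =>
  if q.1 = 0 ∨ q'.1 = 0 then α else if q.1 = 1 ∨ q'.1 = 1 then s else β

/-- Over `ℝ` the primed fugacities are `compassGadgetFugacity`. [folklore] -/
@[simp] theorem compassGadgetFugacity'_real (α β s : ℝ) :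
    compassGadgetFugacity' α β s = compassGadgetFugacity α β s := rfl

/-- **`T_adj(α, β, s)`** of the compass gadget: the generating function of its simple routes
between the adjacent terminals `Q_W`, `Q_N`. [folklore] -/
def compassTadj (α β s : R) : R :=
  terminalGF compassGadgetGraph compassTerm (compassGadgetFugacity' α β s) .W .N

/-- **`T_opp(α, β, s)`**: simple routes between the opposite terminals `Q_W`, `Q_E`. [folklore] -/
def compassTopp (α β s : R) : R :=
  terminalGF compassGadgetGraph compassTerm (compassGadgetFugacity' α β s) .W .E

/-- **`D(α, β, s)`**: vertex-disjoint pairs (route `Q_W → Q_N`, route `Q_S → Q_E`) — the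
non-crossing double passage `{W,N} + {S,E}` of Glazman–Manolescu's weight `w₁`.
[cite: GlazmanManolescu2019, Fig. 1] -/
def compassD (α β s : R) : R :=
  terminalPairGF compassGadgetGraph compassTerm (compassGadgetFugacity' α β s) .W .N .S .E

/-- **`D_cross(α, β, s)`**: vertex-disjoint pairs (route `Q_W → Q_E`, route `Q_S → Q_N`) — the
crossing double passage, absent from Glazman–Manolescu's Fig. 1; the route claims it vanishes for
the (planar) compass gadget. [cite: GlazmanManolescu2019, Fig. 1] -/
def compassDcross (α β s : R) : R :=
  terminalPairGF compassGadgetGraph compassTerm (compassGadgetFugacity' α β s) .W .E .S .N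

/-- The polynomial claimed for `T_adj` in item CompassRealisation of the route (22 routes:
the coefficients sum to `22`). NOT asserted equal to `compassTadj` here.
[cite: GlazmanManolescu2019, eq. (1) (the target weight u₁); the polynomial is the route's computation] -/
def compassTadjPoly (α β s : R) : R :=
  α ^ 2 + α ^ 6 + s ^ 2 * (2 * α ^ 2 * β + 2 * α ^ 2 * β ^ 2 + 2 * α ^ 2 * β ^ 3 + 2 * α ^ 4 * β +
    4 * α ^ 4 * β ^ 2 + 2 * α ^ 4 * β ^ 3 + 2 * α ^ 6 * β + 2 * α ^ 6 * β ^ 3) + 2 * s ^ 4 * α ^ 4 * β ^ 2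

/-- The polynomial claimed for `T_opp` in item CompassRealisation (24 routes). NOT asserted equal
to `compassTopp` here.
[cite: GlazmanManolescu2019, eq. (1) (the target weight v); the polynomial is the route's computation] -/
def compassToppPoly (α β s : R) : R :=
  2 * α ^ 4 + s ^ 2 * (2 * α ^ 2 * β + 4 * α ^ 2 * β ^ 2 + 2 * α ^ 2 * β ^ 3 + 4 * α ^ 4 * β +
    4 * α ^ 4 * β ^ 3 + 4 * α ^ 6 * β ^ 2) + 2 * s ^ 4 * α ^ 4 * β ^ 2

/-- The polynomial claimed for `D` in item CompassRealisation (15 pairs). NOT asserted equal to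
`compassD` here.
[cite: GlazmanManolescu2019, eq. (1) (the target weight w₁); the polynomial is the route's computation] -/
def compassDPoly (α β s : R) : R :=
  α ^ 4 + s ^ 2 * (4 * α ^ 4 * β + 4 * α ^ 4 * β ^ 2 + 4 * α ^ 4 * β ^ 3) + 2 * s ^ 4 * α ^ 4 * β ^ 2

/-- Route count check: `T_adj`'s claimed polynomial has `22` unit terms. [folklore] -/
theorem compassTadjPoly_one : compassTadjPoly (1 : ℕ) 1 1 = 22 := by norm_num [compassTadjPoly]

/-- Route count check: `T_opp`'s claimed polynomial has `24` unit terms. [folklore] -/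
theorem compassToppPoly_one : compassToppPoly (1 : ℕ) 1 1 = 24 := by norm_num [compassToppPoly]

/-- Pair count check: `D`'s claimed polynomial has `15` unit terms. [folklore] -/
theorem compassDPoly_one : compassDPoly (1 : ℕ) 1 1 = 15 := by norm_num [compassDPoly]

end CompassPolynomials

/-- **The compass equations** of item CompassRealisation, in terms of the named polynomials:
`z² T_adj = u₁(π/2)`, `z² T_opp = v(π/2)`, `z⁴ D = w₁(π/2)` with positive fugacities. This is the
predicate only (a `Prop`-valued function of the fugacity vector, not a claim).
[cite: GlazmanManolescu2019, eq. (1)] -/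
def IsCompassSolution (α β s z : ℝ) : Prop :=
  0 < α ∧ 0 < β ∧ 0 < s ∧ 0 < z ∧ z ^ 2 * compassTadjPoly α β s = weightU1 (Real.pi / 2) ∧
    z ^ 2 * compassToppPoly α β s = weightV (Real.pi / 2) ∧ z ^ 4 * compassDPoly α β s = weightW1 (Real.pi / 2)

/-- `IsCompassSolution` is, word for word, the first conjunct of the route's thesis `X`
(the body of item CompassRealisation). [folklore] -/
theorem isCompassSolution_iff (α β s z : ℝ) :
    IsCompassSolution α β s z ↔ (0 < α ∧ 0 < β ∧ 0 < s ∧ 0 < z ∧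
      z ^ 2 * (α ^ 2 + α ^ 6 + s ^ 2 * (2 * α ^ 2 * β + 2 * α ^ 2 * β ^ 2 + 2 * α ^ 2 * β ^ 3 + 2 * α ^ 4 * β +
        4 * α ^ 4 * β ^ 2 + 2 * α ^ 4 * β ^ 3 + 2 * α ^ 6 * β + 2 * α ^ 6 * β ^ 3) + 2 * s ^ 4 * α ^ 4 * β ^ 2) =
          weightU1 (Real.pi / 2) ∧
      z ^ 2 * (2 * α ^ 4 + s ^ 2 * (2 * α ^ 2 * β + 4 * α ^ 2 * β ^ 2 + 2 * α ^ 2 * β ^ 3 + 4 * α ^ 4 * β +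
        4 * α ^ 4 * β ^ 3 + 4 * α ^ 6 * β ^ 2) + 2 * s ^ 4 * α ^ 4 * β ^ 2) = weightV (Real.pi / 2) ∧
      z ^ 4 * (α ^ 4 + s ^ 2 * (4 * α ^ 4 * β + 4 * α ^ 4 * β ^ 2 + 4 * α ^ 4 * β ^ 3) + 2 * s ^ 4 * α ^ 4 * β ^ 2) =
        weightW1 (Real.pi / 2)) :=
  Iff.rfl

/-! ### The plus gadget (`ℤ²` on the same ports) and the union `Γ⁺ = compass ∪ plus` -/

/-- **The plus gadget**: one centre vertex (`W = Unit`, no internal edge) wired to the four ports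
of its face. Its port-gadget lattice is `ℤ²` (the face centres) with every edge subdivided by the
port at its midpoint. [folklore] -/
def plusGadget : PortGadget Unit where
  graph := ⊥
  wired _ := Set.univ

/-- **The plus lattice**: the port-gadget lattice of the plus gadget. [folklore] -/
abbrev plusLattice : SimpleGraph (MidEdge ⊕ Face × Unit) := plusGadget.lattice

/-- The plus fugacity: `p` on every (port–centre) edge. [folklore] -/
def plusFugacity (p : ℝ) : MidEdge ⊕ Face × Unit → MidEdge ⊕ Face × Unit → ℝ :=
  PortGadget.fugacity (fun _ _ => 0) fun _ => p

/-- The centre of the plus gadget sits at the centre of its face. [folklore] -/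
def plusPos : Unit → ℂ := fun _ => (1 + Complex.I) / 2

/-- Port — centre adjacency in the plus lattice: the port lies on a side of the face. [folklore] -/
@[simp] theorem plusLattice_adj_inl_inr (e : MidEdge) (f : Face) (u : Unit) :
    plusLattice.Adj (.inl e) (.inr (f, u)) ↔ ∃ s, f.side s = e := by
  simp [plusLattice, plusGadget]

/-- Centre — port adjacency in the plus lattice. [folklore] -/
@[simp] theorem plusLattice_adj_inr_inl (e : MidEdge) (f : Face) (u : Unit) :
    plusLattice.Adj (.inr (f, u)) (.inl e) ↔ ∃ s, f.side s = e := by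
  simp [plusLattice, plusGadget]

/-- No two centres are adjacent in the plus lattice. [folklore] -/
@[simp] theorem plusLattice_adj_inr_inr (f f' : Face) (u u' : Unit) :
    ¬plusLattice.Adj (.inr (f, u)) (.inr (f', u')) := by
  simp [plusLattice, plusGadget]

/-- Every edge of the plus lattice has fugacity `p`. [folklore] -/
theorem plusFugacity_of_adj (p : ℝ) {x x' : MidEdge ⊕ Face × Unit} (h : plusLattice.Adj x x') :
    plusFugacity p x x' = p := by
  rcases x with e | ⟨f, u⟩ <;> rcases x' with e' | ⟨f', u'⟩
  · simp at h
  · rfl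
  · rfl
  · simp at h

/-- **Weights on the plus lattice**: a walk of length `n` has weight `p ^ n` (so a port-to-port
self-avoiding path through `m` centres, i.e. `m` edges of `ℤ²`, has weight `p ^ (2m)`).
[folklore] -/
theorem walkWeight_plusFugacity (p : ℝ) {x x' : MidEdge ⊕ Face × Unit} (w : plusLattice.Walk x x') :
    PortGadget.walkWeight (plusFugacity p) w = p ^ w.length := by
  induction w with
  | nil => simp
  | cons h w ih => rw [PortGadget.walkWeight_cons, ih, plusFugacity_of_adj p h, SimpleGraph.Walk.length_cons, pow_succ']

/-- **`Γ⁺ = compass ∪ plus`**: both gadgets in every face, on the same ports (a port is wired to the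
compass terminal and to the plus centre of each adjacent face). [folklore] -/
def compassPlusGadget : PortGadget ((Fin 3 × Fin 4) ⊕ Unit) :=
  compassGadget.sum plusGadget

/-- The lattice `Γ⁺`. [folklore] -/
abbrev compassPlusLattice : SimpleGraph (MidEdge ⊕ Face × ((Fin 3 × Fin 4) ⊕ Unit)) :=
  compassPlusGadget.lattice

/-- The five fugacity classes of `Γ⁺`: `α, β, s` inside the compass gadget, `z` on compass
port–terminal edges, `p` on plus port–centre edges (no edge joins the two gadgets). [folklore] -/
def compassPlusFugacity (α β s z p : ℝ) :
    MidEdge ⊕ Face × ((Fin 3 × Fin 4) ⊕ Unit) → MidEdge ⊕ Face × ((Fin 3 × Fin 4) ⊕ Unit) → ℝ :=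
  PortGadget.fugacity
    (fun w w' => match w, w' with
      | .inl q, .inl q' => compassGadgetFugacity α β s q q'
      | _, _ => 0)
    (Sum.elim (fun _ => z) (fun _ => p))

/-- The drawing of `Γ⁺`: compass positions and the face centre. (The plus centre coincides with no
compass vertex: all compass vertices are off-centre.) [folklore] -/
def compassPlusPos : (Fin 3 × Fin 4) ⊕ Unit → ℂ := Sum.elim compassPos plusPos

namespace PortGadget

variable {W₁ W₂ : Type*}

/-- The first gadget's lattice sits inside the union lattice (as an induced subgraph on its
vertices). [folklore] -/
def sumInl (K₁ : PortGadget W₁) (K₂ : PortGadget W₂) : K₁.lattice ↪g (K₁.sum K₂).lattice where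
  toFun := Sum.map id (Prod.map id Sum.inl)
  inj' := Function.injective_id.sumMap (Function.injective_id.prodMap Sum.inl_injective)
  map_rel_iff' {x x'} := by
    rcases x with e | ⟨f, w⟩ <;> rcases x' with e' | ⟨f', w'⟩ <;>
      simp [PortGadget.sum, lattice_adj_inr_inr]

/-- The second gadget's lattice sits inside the union lattice. [folklore] -/
def sumInr (K₁ : PortGadget W₁) (K₂ : PortGadget W₂) : K₂.lattice ↪g (K₁.sum K₂).lattice where
  toFun := Sum.map id (Prod.map id Sum.inr)
  inj' := Function.injective_id.sumMap (Function.injective_id.prodMap Sum.inr_injective)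
  map_rel_iff' {x x'} := by
    rcases x with e | ⟨f, w⟩ <;> rcases x' with e' | ⟨f', w'⟩ <;>
      simp [PortGadget.sum, lattice_adj_inr_inr]

/-- No edge of the union lattice joins the two gadgets. [folklore] -/
@[simp] theorem sum_lattice_not_adj_inl_inr (K₁ : PortGadget W₁) (K₂ : PortGadget W₂) (f f' : Face)
    (w : W₁) (w' : W₂) : ¬(K₁.sum K₂).lattice.Adj (.inr (f, .inl w)) (.inr (f', .inr w')) := by
  simp [PortGadget.sum, lattice_adj_inr_inr]

end PortGadget

/-- The compass lattice inside `Γ⁺`. [folklore] -/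
def compassIntoPlus : compassLattice ↪g compassPlusLattice :=
  (compassGadget_lattice ▸ compassGadget.sumInl plusGadget :)

/-- The plus lattice inside `Γ⁺`. [folklore] -/
def plusIntoCompassPlus : plusLattice ↪g compassPlusLattice :=
  compassGadget.sumInr plusGadget

/-! ### The requested name -/

/-- **The port-gadget lattice**, under the name of the definition request `defn-portGadgetLattice`:
an alias of `PortGadget.lattice` (the simple graph on `MidEdge ⊕ Face × W` of the gadget `K`
copied into every face of the square tiling, ports on the edges). [folklore] -/
abbrev portGadgetLattice {W : Type*} (K : PortGadget W) : SimpleGraph (MidEdge ⊕ Face × W) :=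
  K.lattice

/-- The alias unfolds to `PortGadget.lattice`. [folklore] -/
theorem portGadgetLattice_eq {W : Type*} (K : PortGadget W) : portGadgetLattice K = K.lattice := rfl

/-- The compass lattice is the port-gadget lattice of the compass gadget (alias form). [folklore] -/
theorem portGadgetLattice_compassGadget : portGadgetLattice compassGadget = compassLattice :=
  compassGadget_lattice

end Literature.Probability.RandomPlanarGeometry.SAW
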